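import Summits.MatrixMultiplication.MatrixMultiplication.Theorems.LevelOneGL2Designs.Negative.LevelSpace
import Summits.MatrixMultiplication.MatrixMultiplication.Theorems.LevelOneGL2Designs.Negative.Moat

/-!
# Negative lemmas for the crux `LevelOneGL2Designs` (stmt-MatrixMultiplication-14080), part M2:
the moat inequality for graded designs

Refuter-side (cdisprove) analysis; no theorem asserts a Theses statement positively.
* `card_mul_card_le_finrank_inf_SuppFun` — the `|X||Z|` separators of an `F_k`-separated triple
  are independent level-`k` functions supported OFF the garbage `{x⁻¹yy'⁻¹z : y ≠ y'}`.
* `moat` — hence, by part M's moat inequality for the left-invariant `F_k|_G`: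
  `|GL_m(𝔽_p)|·|X|·|Z| ≤ |GL_m(𝔽_p) ∖ garbage| · N_k` — the garbage misses at least the fraction
  `|X||Z|/N_k` of the group (ideator 3's N2 for the crux).
* `moat_levelOne` — at `(2,1)` with part A's numbers: `(p²−1)(p²−p)|X||Z| ≤ |G ∖ garbage|(p³+p²−p)`,
  so the garbage of a crux witness misses `≥ (c² − o(1))|GL_2(𝔽_p)|` elements.
-/

noncomputable section

namespace Summit.MatrixMultiplication.MatrixMultiplication.Theorems.LevelOneGL2Designs.Negative

open Summit.MatrixMultiplication.MatrixMultiplication.Theses.LevelGradedCohnUmans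
open Summit.MatrixMultiplication.MatrixMultiplication.Theorems.LieRankDesigns.Negative
/-! ### The design corollary: the garbage of a separated triple misses `≥ |X||Z|·|G|/N_k` points -/

section Design

variable {p m k : ℕ} [Fact p.Prime]

/-- **The separators span `≥ |X||Z|` dimensions of level-`k` functions supported OFF the garbage.** -/
theorem card_mul_card_le_finrank_inf_SuppFun {X Y Z : Finset (GLm p m)} (hsep : RankSep k X Y Z)
    (hY : Y.Nonempty) :
    X.card * Z.card ≤ Module.finrank ℂ
      ↥(levelSubmodule p m k ⊓ Moat.SuppFun (Finset.univ \ garbage X Y Z)) := by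
  classical
  obtain ⟨y₀, hy₀⟩ := hY
  set J := levelSubmodule p m k ⊓ Moat.SuppFun (Finset.univ \ garbage X Y Z)
  -- restriction to the targets x⁻¹ z
  let r : J →ₗ[ℂ] (↥(X ×ˢ Z) → ℂ) :=
    { toFun := fun f t => (f : GLm p m → ℂ) (t.1.1⁻¹ * t.1.2)
      map_add' := fun f f' => by funext t; rfl
      map_smul' := fun a f => by funext t; rfl }
  have hsurj : Function.Surjective r := by
    rw [← LinearMap.range_eq_top, eq_top_iff, ← (Pi.basisFun ℂ _).span_eq, Submodule.span_le]
    rintro _ ⟨⟨⟨x₀, z₀⟩, ht₀⟩, rfl⟩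
    rw [Finset.mem_product] at ht₀
    obtain ⟨c, hc, hsepc⟩ := hsep x₀ ht₀.1 z₀ ht₀.2
    have hfJ : fourierFn c ∈ J := by
      refine ⟨mem_levelSubmodule_iff.mpr ⟨c, hc, fun g => rfl⟩, fun g hg => ?_⟩
      rw [Finset.mem_sdiff, not_and_or, not_not] at hg
      rcases hg with hg | hg
      · exact absurd (Finset.mem_univ g) hg
      · exact sep_eq_zero_of_mem_garbage hsepc hg
    refine ⟨⟨fourierFn c, hfJ⟩, ?_⟩
    funext t
    obtain ⟨⟨x, z⟩, ht⟩ := t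
    rw [Finset.mem_product] at ht
    simp only [r, LinearMap.coe_mk, AddHom.coe_mk, Pi.basisFun_apply]
    rw [show x⁻¹ * z = x⁻¹ * y₀ * y₀⁻¹ * z by group, hsepc x ht.1 y₀ hy₀ y₀ hy₀ z ht.2,
      Pi.single_apply]
    congr 1
    simp only [true_and, Subtype.mk.injEq, Prod.mk.injEq]
  have h := LinearMap.finrank_le_finrank_of_surjective hsurj
  rwa [Module.finrank_fintype_fun_eq_card, Fintype.card_coe, Finset.card_product] at h

/-- **MOAT INEQUALITY FOR GRADED DESIGNS** (ideator 3's N2, proved): for every `F_k`-separated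
triple in `GL_m(𝔽_p)` with `Y ≠ ∅`,
`|GL_m(𝔽_p)| · |X| · |Z| ≤ |GL_m(𝔽_p) ∖ garbage| · N_k`, i.e. the garbage `{x⁻¹yy'⁻¹z : y ≠ y'}`
misses at least the fraction `|X||Z|/N_k` of the group (`≈ c²` for the crux at `(2,1)`, where
`|G|/N₁ ≈ p`: the garbage of a witness misses `≳ c²p⁴` elements although it is a union of
`|Y|(|Y|−1) ≈ c²p³` translated copies of sets of size `≥ c p^{3/2}`). -/
theorem moat {X Y Z : Finset (GLm p m)} (hsep : RankSep k X Y Z) (hY : Y.Nonempty) :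
    Fintype.card (GLm p m) * (X.card * Z.card)
      ≤ (Finset.univ \ garbage X Y Z).card * Fintype.card ({M : Mat p m // M.rank ≤ k}) := by
  classical
  have h1 := card_mul_card_le_finrank_inf_SuppFun hsep hY
  have h2 := Moat.card_mul_finrank_inf_SuppFun_le (levelSubmodule p m k)
    (fun f hf h => levelSubmodule_left_inv f hf h) (Finset.univ \ garbage X Y Z)
  have h3 : (Finset.univ \ garbage X Y Z).card * Module.finrank ℂ ↥(levelSubmodule p m k)
      ≤ (Finset.univ \ garbage X Y Z).card * Fintype.card ({M : Mat p m // M.rank ≤ k}) :=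
    Nat.mul_le_mul_left _ finrank_levelSubmodule_le
  calc Fintype.card (GLm p m) * (X.card * Z.card)
      ≤ Fintype.card (GLm p m) * Module.finrank ℂ
          ↥(levelSubmodule p m k ⊓ Moat.SuppFun (Finset.univ \ garbage X Y Z)) :=
        Nat.mul_le_mul_left _ h1
    _ ≤ _ := h2.trans h3


end Design

/-- **Moat inequality at `(2,1)` with explicit numbers**: for every rank-1-separated triple of
`GL_2(𝔽_p)` with `Y ≠ ∅`, `(p²−1)(p²−p)·|X|·|Z| ≤ |GL_2(𝔽_p) ∖ garbage| · (p³+p²−p)`; for a crux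
witness (`|X||Z| ≥ c²p³`) the garbage misses `≥ (c² − o(1))·|GL_2(𝔽_p)|` elements. -/
theorem moat_levelOne {p : ℕ} [Fact p.Prime] {X Y Z : Finset (GLm p 2)} (hsep : RankSep 1 X Y Z)
    (hY : Y.Nonempty) :
    (p ^ 2 - 1) * (p ^ 2 - p) * (X.card * Z.card)
      ≤ (Finset.univ \ garbage X Y Z).card * (p ^ 3 + p ^ 2 - p) := by
  rw [← card_GL2, ← card_rankLE_two_one]
  exact moat hsep hY

end Summit.MatrixMultiplication.MatrixMultiplication.Theorems.LevelOneGL2Designs.Negative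

end
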